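import Literature.NumberTheory.Sieve.LevelOfDistribution
import HarnessLib

/-!
# `GEH[ϑ]` for finitely many families at once (the uniformity behind Polymath 8b §4.5 and Prop. 2.7)

Trunk AntSieve, tooling toward the named fact `Literature.NumberTheory.Sieve.weakDHL_three_two_of_GEH`
(D. H. J. Polymath, *Variants of the Selberg sieve, and bounded intervals containing many primes*,
Res. Math. Sci. 1:12 (2014) = arXiv:1407.4897, Theorem 3.2(xii)).  Every use of the generalized
Elliott–Halberstam hypothesis `GEH[ϑ]` (Claim 2.6) in the printed proof — Proposition 2.7
(`GEH ⟹ EH`, via Vaughan's identity) and §4.5 (Theorem 3.6(ii)) — applies it to a family of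
`O(log^{O(A)} x)` convolutions `α ⋆ β` at once ("partition … by `O(log^{A+1} x)` intervals", p. 7
and p. 17) and sums the bounds.  In print this is free: the implied constant in Claim 2.6 depends
only on the fixed quantities.  The tree's rendering `GeneralizedElliottHalberstam ϑ`
(`LevelOfDistribution.lean`) quantifies over ONE family `(α_x, β_x)_x` and concludes `IsBigO`, whose
constant may depend on the family.  This file PROVES that the uniform version nevertheless follows
(`GeneralizedElliottHalberstam.finite_family`): given finitely many families at each `x`
(indexed by `j < J(x)`) satisfying the hypotheses of Claim 2.6 with common constants, ONE constant
bounds all of them eventually — by applying `GEH[ϑ]` to the diagonal family that picks, at each `x`,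
the index with the largest discrepancy sum (a finite maximum).

## References

* [Polymath8b2014] D. H. J. Polymath, Res. Math. Sci. 1 (2014), Art. 12 = arXiv:1407.4897,
  Claim 2.6 (p. 6), Proposition 2.7 (p. 7), §4.5 (p. 17).
-/

noncomputable section

open Filter Asymptotics Finset
open scoped ArithmeticFunction.sigma

namespace Literature.NumberTheory.Sieve

/-- The discrepancy sum of Claim 2.6 for one pair `(α, β)` at scales `N, M` (support ratio `K`):
`Σ_{q ≤ x^ϑ} sup_{a ∈ (ℤ/qℤ)ˣ} |Δ(α ⋆ β; a (q))|`, with the cut-off `⌊K²NM⌋` of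
`GeneralizedElliottHalberstam`. [cite: Polymath8b2014, Claim 2.6] -/
def gehSum (θ K : ℝ) (x N M : ℝ) (α β : ArithmeticFunction ℝ) : ℝ :=
  ∑ q ∈ Icc 1 ⌊x ^ θ⌋₊,
    ⨆ a : (ZMod q)ˣ, |apDiscrepancy (fun n => (α * β) n) ⌊K * K * (N * M)⌋₊ q a|

/-- The discrepancy sum is nonnegative. [folklore] -/
theorem gehSum_nonneg (θ K x N M : ℝ) (α β : ArithmeticFunction ℝ) : 0 ≤ gehSum θ K x N M α β :=
  Finset.sum_nonneg fun _ _ => Real.iSup_nonneg fun _ => abs_nonneg _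

/-- **`GEH[ϑ]` for finitely many families at once.**  Let `J(x) ≥ 1` eventually, and for each `x`
and `j < J(x)` let `N_{x,j}, M_{x,j}` be scales and `α_{x,j}, β_{x,j}` coefficient sequences obeying
the hypotheses of Claim 2.6 UNIFORMLY in `j` (same `ε, k, K`, same constants, eventually in `x` for
all `j < J(x)` simultaneously).  Then `GEH[ϑ]` bounds all the discrepancy sums by one
`C x log^{-A} x` eventually.  (Proof: apply `GEH[ϑ]` to the diagonal family
`x ↦ (α_{x,j*(x)}, β_{x,j*(x)})` maximising the sum.) [cite: Polymath8b2014, Claim 2.6 (uniformity in the implied constant, used in Proposition 2.7 and §4.5)] -/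
theorem GeneralizedElliottHalberstam.finite_family {θ : ℝ} (hGEH : GeneralizedElliottHalberstam θ)
    {ε : ℝ} (hε : 0 < ε) {A : ℝ} (hA : 0 < A) (k : ℕ) {K : ℝ} (hK : 1 ≤ K)
    (J : ℝ → ℕ) (hJ : ∀ᶠ x in atTop, 0 < J x)
    (N M : ℝ → ℕ → ℝ) (α β : ℝ → ℕ → ArithmeticFunction ℝ)
    (h1 : ∀ᶠ x in atTop, ∀ j < J x,
      x ^ ε ≤ N x j ∧ N x j ≤ x ^ (1 - ε) ∧ x ^ ε ≤ M x j ∧ M x j ≤ x ^ (1 - ε))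
    (h2 : ∃ C : ℝ, 1 ≤ C ∧ ∀ᶠ x in atTop, ∀ j < J x, x / C ≤ N x j * M x j ∧ N x j * M x j ≤ C * x)
    (h3 : ∀ x j, ∀ n : ℕ, (n : ℝ) < N x j ∨ K * N x j < n → α x j n = 0)
    (h4 : ∀ x j, ∀ n : ℕ, (n : ℝ) < M x j ∨ K * M x j < n → β x j n = 0)
    (h5 : ∀ᶠ x in atTop, ∀ j < J x, ∀ n : ℕ, |α x j n| ≤ (σ 0 n : ℝ) ^ k * Real.log x ^ k ∧
      |β x j n| ≤ (σ 0 n : ℝ) ^ k * Real.log x ^ k)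
    (h6 : ∀ B : ℝ, 0 < B → ∃ C : ℝ, ∀ᶠ x in atTop, ∀ j < J x, ∀ q r : ℕ, 1 ≤ q → 1 ≤ r →
      ∀ a : (ZMod q)ˣ, |apDiscrepancy (fun n => if n.Coprime r then β x j n else 0) ⌊K * M x j⌋₊ q a| ≤
        C * (σ 0 (q * r) : ℝ) ^ k * M x j / Real.log x ^ B) :
    ∃ C : ℝ, ∀ᶠ x in atTop, ∀ j < J x,
      gehSum θ K x (N x j) (M x j) (α x j) (β x j) ≤ C * (x / Real.log x ^ A) := by
  classical
  -- the index with the largest discrepancy sum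
  have hmax : ∀ x, ∃ j₀ : ℕ, 0 < J x → j₀ < J x ∧ ∀ j < J x,
      gehSum θ K x (N x j) (M x j) (α x j) (β x j) ≤ gehSum θ K x (N x j₀) (M x j₀) (α x j₀) (β x j₀) := by
    intro x
    by_cases hx : 0 < J x
    · obtain ⟨j₀, hj₀, hmax⟩ := Finset.exists_max_image (Finset.range (J x))
        (fun j => gehSum θ K x (N x j) (M x j) (α x j) (β x j)) ⟨0, Finset.mem_range.2 hx⟩
      exact ⟨j₀, fun _ => ⟨Finset.mem_range.1 hj₀, fun j hj => hmax j (Finset.mem_range.2 hj)⟩⟩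
    · exact ⟨0, fun h => (hx h).elim⟩
  choose js hjs using hmax
  -- the diagonal family obeys the hypotheses of `GEH[ϑ]`
  have d1 : ∀ᶠ x in atTop, x ^ ε ≤ N x (js x) ∧ N x (js x) ≤ x ^ (1 - ε) ∧
      x ^ ε ≤ M x (js x) ∧ M x (js x) ≤ x ^ (1 - ε) := by
    filter_upwards [h1, hJ] with x hx hJx using hx _ (hjs x hJx).1
  have d2 : ∃ C : ℝ, 1 ≤ C ∧ ∀ᶠ x in atTop,
      x / C ≤ N x (js x) * M x (js x) ∧ N x (js x) * M x (js x) ≤ C * x := by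
    obtain ⟨C, hC, h⟩ := h2
    exact ⟨C, hC, by filter_upwards [h, hJ] with x hx hJx using hx _ (hjs x hJx).1⟩
  have d5 : ∀ᶠ x in atTop, ∀ n : ℕ, |α x (js x) n| ≤ (σ 0 n : ℝ) ^ k * Real.log x ^ k ∧
      |β x (js x) n| ≤ (σ 0 n : ℝ) ^ k * Real.log x ^ k := by
    filter_upwards [h5, hJ] with x hx hJx using hx _ (hjs x hJx).1
  have d6 : ∀ B : ℝ, 0 < B → ∃ C : ℝ, ∀ᶠ x in atTop, ∀ q r : ℕ, 1 ≤ q → 1 ≤ r → ∀ a : (ZMod q)ˣ,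
      |apDiscrepancy (fun n => if n.Coprime r then β x (js x) n else 0) ⌊K * M x (js x)⌋₊ q a| ≤
        C * (σ 0 (q * r) : ℝ) ^ k * M x (js x) / Real.log x ^ B := by
    intro B hB
    obtain ⟨C, h⟩ := h6 B hB
    exact ⟨C, by filter_upwards [h, hJ] with x hx hJx using hx _ (hjs x hJx).1⟩
  have key := hGEH ε hε A hA k K hK (fun x => N x (js x)) (fun x => M x (js x))
    (fun x => α x (js x)) (fun x => β x (js x)) d1 d2 (fun x => h3 x (js x)) (fun x => h4 x (js x)) d5 d6
  obtain ⟨c, hc⟩ := key.bound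
  refine ⟨max c 0, ?_⟩
  filter_upwards [hc, hJ, eventually_gt_atTop (1 : ℝ)] with x hx hJx hx1 j hj
  have hle := (hjs x hJx).2 j hj
  have hpos : 0 < x / Real.log x ^ A := div_pos (by linarith) (Real.rpow_pos_of_pos (Real.log_pos hx1) A)
  rw [Real.norm_eq_abs, Real.norm_eq_abs, abs_of_pos hpos] at hx
  have hx' : gehSum θ K x (N x (js x)) (M x (js x)) (α x (js x)) (β x (js x)) ≤ c * (x / Real.log x ^ A) := by
    refine le_trans (le_abs_self _) ?_
    exact hx
  calc gehSum θ K x (N x j) (M x j) (α x j) (β x j)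
      ≤ gehSum θ K x (N x (js x)) (M x (js x)) (α x (js x)) (β x (js x)) := hle
    _ ≤ c * (x / Real.log x ^ A) := hx'
    _ ≤ max c 0 * (x / Real.log x ^ A) := mul_le_mul_of_nonneg_right (le_max_left _ _) hpos.le

end Literature.NumberTheory.Sieve
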